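import Summits.BirchSwinnertonDyer.BirchSwinnertonDyer.Theorems.ByReductionTypeAtTwoRankOneAtTwoOneDoorLawBottomDefs
import Literature.NumberTheory.EllipticCurves.SelmerGaloisAction
import Literature.NumberTheory.EllipticCurves.SelmerTorsionRestriction
import Literature.NumberTheory.EllipticCurves.HeegnerPointsKolyvaginEulerSystem
import Literature.NumberTheory.EllipticCurves.HeegnerPointsOfConductor
import HarnessLib

/-!
# Route ByReductionTypeAtTwo, crux `RankOneAtTwoBigImageOddLocal` (stmt-BirchSwinnertonDyer-23715), LINE v8.9 `one_door_analytic`: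
# the INPUT of Kolyvagin's first `2`-descent over `ℚ` in TREE currency — `FirstDescentInput`, `FirstDescentLeavesAtTwoBottom`

Lead prover seat `bsd-line-fkl-p1` g12 (2026-08-28).  Statements + import-light bookkeeping only (kind definition); nothing is
asserted; BSD is not proved by any of this.  Pattern of route GenusKolyvaginAtTwo's `GenusExact.VisiblePairAtTwo.Input`
(`Theorems/GenusKolyvaginAtTwoVisiblePairAtTwoDefs.lean`, p638903): the displayed inputs of an abstract descent engine, bundled as a
record over the tree's Galois-cohomology carriers, so that (i) the engine's instantiation is ONE kernel theorem
(`Theorems/…OneDoorBottomFrame.lean`: `FirstDescentInput W Wd ⟹ #Sel₂(W/ℚ) = 2 ∧ Sel₂(Wd/ℚ) = ⊥`), (ii) the registered bottom-rung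
stub `stub_doorUpperBottom : S_pub4 → DoorIndexLawUpperCAtTwoBottom` (U₀, skeleton v8.8) becomes the statement
`FirstDescentLeavesAtTwoBottom` below («at every bottom-rung datum the input EXISTS») through PROVED glue (the frame theorem, the
width seat's Selmer-to-door glue `doorIndexLawUpperCAtTwoBottom_of_selmerTwo` and parity leaf `twin_selmerTwo_even_at`), and
(iii) each remaining leaf is a FIELD with a fixed tree signature that width seats and route GenusKolyvaginAtTwo's bricks discharge
one at a time.

The engine (lead g11/g12): `Theorems/…OneDoorFirstDescentAtTwo.lean` (p637958; E-side, one group `V₁ = H¹(ℚ, E[2])`: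
`Sel₂(E/ℚ) = {0, y}`) and `Theorems/…OneDoorFirstDescentPairAtTwo.lean` (g12; twin side in its own group `V₂ = H¹(ℚ, E^{(d)}[2])`
with the CROSS form of Gross 6.2 (2): `Sel₂(E^{(d)}/ℚ) = 0`).  Carriers: `galH1Torsion X 2 = H¹(ℚ, X[2])`, local conditions
`selmerLocalKer` (Kummer condition, `locAt`) and `torsionLocalKer` (strict condition `res_v = 0`, `strictAt`) at a place
`v : HeightOneSpectrum (𝓞 ℚ) ⊕ InfinitePlace ℚ`, `selmerGroup X 2`.  The error place `q₀`, the Kolyvagin primes `Kol` with their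
places `pl`, the class `y` (at instantiation `δ(T·y_K)`, `T = #E(K)_tors`) and the first-layer classes `c₁ ℓ ∈ H¹(ℚ, W[2])`,
`c₂ ℓ ∈ H¹(ℚ, Wd[2])` (Kolyvagin's `d(ℓ)` at `M = 2`, descended to `ℚ` on either curve — at `M = 2` the signs of Gross Prop. 5.4 are
invisible) are DATA of the record; the leaves are its Prop fields: Gross 6.2 (1) off `{ℓ, q₀}` on each side, 6.2 (2) in direct and
cross form, reciprocity (Poitou–Tate + the perfect pairing of the two lines at `ℓ`) on each side, Čebotarev at `M = 2` (three shapes),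
Mazur–Rubin 2010 Lemma 2.2 (i) at `q₀` on each side.  SIGN-FREE: at `Δ_W < 0` take `q₀ = v_{q₀}` (the one transposition prime of the
minimal door) and Gross's primes (`Frob_ℓ = [c]`, a transposition on `E[2]`); at `Δ_W > 0` take `q₀ = ∞` and REGULAR primes
(MEMO-es §18.11).  Parity (`heven`) and the Heegner-point bookkeeping are NOT fields: they are tree theorems modulo PRINT
(`twin_selmerTwo_even_at`, Cassels–Tate; `exists_unique_exponent_at_door`).

References (locators): Gross 1991 §§3, 6, 8–10 (Props. 3.7, 5.4, 6.2, 8.2, 9.1, §10); McCallum 1991 p. 299, Cor. 3.2, Lemma 4.3,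
Prop. 4.4, Lemma 5.3; Mazur–Rubin 2010 Lemmas 2.2, 2.9–2.10, Def. 3.1; Kramer 1981 Props. 3, 6; Kolyvagin 1989 §3 (the pair `(E, E^D)`).
-/

set_option autoImplicit false

noncomputable section

open scoped Classical

set_option linter.dupNamespace false

namespace Summit.BirchSwinnertonDyer.BirchSwinnertonDyer.Theorems.RankOneAtTwoOneDoor

open WeierstrassCurve NumberField IsDedekindDomain
  Literature.NumberTheory.EllipticCurves Literature.NumberTheory.EllipticCurves.ModularForms
  Summit.BirchSwinnertonDyer.Rank1Residual.F1Sign2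
  Summit.BirchSwinnertonDyer.Rank1Residual.F1Sign2.TranspositionDoor

/-! ### The carriers: local conditions indexed by ALL places of `ℚ` -/

/-- The places of `ℚ`: finite (`HeightOneSpectrum (𝓞 ℚ)`) or infinite (`InfinitePlace ℚ`) — the index type of the engine's local
conditions (as in `GenusExact.VisiblePairAtTwo.loc₁`). [folklore] -/
abbrev RatPlace : Type := HeightOneSpectrum (𝓞 ℚ) ⊕ InfinitePlace ℚ

/-- **Kummer (Selmer) local condition** of `X/ℚ` at a place, in `H¹(ℚ, X[n])`: `selmerLocalKer X ℚ_v n = ker (H¹(ℚ, X[n]) → H¹(ℚ_v, X))`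
(`= im E(ℚ_v)/n` by the local Kummer sequence). [cite: SilvermanAEC2009, X.§4] -/
def locAt (X : WeierstrassCurve ℚ) (n : ℤ) : RatPlace → AddSubgroup (galH1Torsion X n) :=
  Sum.elim (fun v => selmerLocalKer X (v.adicCompletion ℚ) n) (fun w => selmerLocalKer X w.Completion n)

/-- **Strict local condition** of `X/ℚ` at a place, in `H¹(ℚ, X[n])`: `torsionLocalKer X ℚ_v n = ker (H¹(ℚ, X[n]) → H¹(ℚ_v, X[n]))`
(«`s_v = 0`», Gross 1991 Prop. 8.2; McCallum 1991 §3 (3)). [cite: GrossLMS1991, Prop. 8.2] -/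
def strictAt (X : WeierstrassCurve ℚ) (n : ℤ) : RatPlace → AddSubgroup (galH1Torsion X n) :=
  Sum.elim (fun v => X.torsionLocalKer (v.adicCompletion ℚ) n) (fun w => X.torsionLocalKer w.Completion n)

/-- `locAt` at a finite place (unfolding). [folklore] -/
@[simp] theorem locAt_inl (X : WeierstrassCurve ℚ) (n : ℤ) (v : HeightOneSpectrum (𝓞 ℚ)) :
    locAt X n (Sum.inl v) = selmerLocalKer X (v.adicCompletion ℚ) n := rfl

/-- `locAt` at an infinite place (unfolding). [folklore] -/
@[simp] theorem locAt_inr (X : WeierstrassCurve ℚ) (n : ℤ) (w : InfinitePlace ℚ) :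
    locAt X n (Sum.inr w) = selmerLocalKer X w.Completion n := rfl

/-- `strictAt` at a finite place (unfolding). [folklore] -/
@[simp] theorem strictAt_inl (X : WeierstrassCurve ℚ) (n : ℤ) (v : HeightOneSpectrum (𝓞 ℚ)) :
    strictAt X n (Sum.inl v) = X.torsionLocalKer (v.adicCompletion ℚ) n := rfl

/-- `strictAt` at an infinite place (unfolding). [folklore] -/
@[simp] theorem strictAt_inr (X : WeierstrassCurve ℚ) (n : ℤ) (w : InfinitePlace ℚ) :
    strictAt X n (Sum.inr w) = X.torsionLocalKer w.Completion n := rfl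

/-- **`strictAt ≤ locAt`**: a class vanishing in `H¹(ℚ_v, X[n])` vanishes in `H¹(ℚ_v, X)` (tree `torsionLocalKer_le_selmerLocalKer`).
[cite: GrossLMS1991, (7.4)] -/
theorem strictAt_le_locAt (X : WeierstrassCurve ℚ) (n : ℤ) (v : RatPlace) : strictAt X n v ≤ locAt X n v := by
  cases v with
  | inl v => exact X.torsionLocalKer_le_selmerLocalKer (v.adicCompletion ℚ) n
  | inr w => exact X.torsionLocalKer_le_selmerLocalKer w.Completion n

/-- **The Selmer group is cut out by `locAt`**: `s ∈ Sel^(n)(X/ℚ) ↔ ∀ v, s ∈ locAt X n v` (tree `mem_selmerGroup_iff`, re-indexed by the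
sum type of places) — the hypothesis `hsel` of the engine. [cite: SilvermanAEC2009, X.§4] -/
theorem mem_selmerGroup_iff_forall_locAt (X : WeierstrassCurve ℚ) (n : ℤ) (s : galH1Torsion X n) :
    s ∈ selmerGroup X n ↔ ∀ v : RatPlace, s ∈ locAt X n v := by
  rw [mem_selmerGroup_iff]
  constructor
  · rintro ⟨h₁, h₂⟩ (v | w)
    · exact h₁ v
    · exact h₂ w
  · intro h
    exact ⟨fun v => h (Sum.inl v), fun w => h (Sum.inr w)⟩

/-! ### The input record of the first `2`-descent over `ℚ` (two-space form) -/

/-- **`FirstDescentInput W Wd` — the displayed inputs of Kolyvagin's first `2`-descent over `ℚ` for the pair `(W, Wd)`**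
(`Wd` a model of `W^{(d_K)}`), in tree currency: an error place `q₀`, Kolyvagin primes `Kol` with places `pl`, a Selmer class
`y ∈ Sel₂(W/ℚ) ∖ 0` (at instantiation `δ(T·y_K)`), first-layer classes `c₁ ℓ ∈ H¹(ℚ, W[2])`, `c₂ ℓ ∈ H¹(ℚ, Wd[2])`, and the leaves:
Gross 6.2 (1) off `{ℓ, q₀}` (`c₁_loc`, `c₂_loc`), 6.2 (2) direct and across (`c₁_loc_iff`, `c₂_loc_iff`), reciprocity
(`rec₁`, `rec₂`: Poitou–Tate + perfect pairing of the two lines at `ℓ`), Čebotarev at `M = 2` (`ceb₁`, `ceb₂`, `ceb₂'`), Mazur–Rubin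
Lemma 2.2 (i) at `q₀` (`line₁`, `line₂`).  These are EXACTLY the hypotheses of `eq_zero_or_eq_heegner_of_mem_sel` / `card_sel_eq_two`
(`…OneDoorFirstDescentAtTwo.lean`) with `V = galH1Torsion W 2`, `Loc = locAt W 2`, `A ℓ = strictAt W 2 (pl ℓ)`, `A₀ = strictAt W 2 q₀`,
and of `twinSel_eq_bot₂` (`…OneDoorFirstDescentPairAtTwo.lean`) with `V₂ = galH1Torsion Wd 2`, minus parity (a tree theorem modulo
Cassels–Tate, `twin_selmerTwo_even_at`). [cite: GrossLMS1991, Props. 6.2, 8.2, 9.1 and §10] [cite: McCallumLMS1991, Cor. 3.2, Lemma 4.3,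
Prop. 4.4, Lemma 5.3] [cite: MazurRubin2010, Lemmas 2.2 (i), 2.10] -/
structure FirstDescentInput (W : WeierstrassCurve ℚ) (Wd : WeierstrassCurve ℚ) where
  /-- The error place of the minimal door (`v_{q₀}` at `Δ_W < 0`, the real place at `Δ_W > 0`). -/
  q₀ : RatPlace
  /-- The Kolyvagin primes used (at `M = 2`: Frobenius a transposition on `E[2]`, inert in `K`). -/
  Kol : ℕ → Prop
  /-- The place of a Kolyvagin prime. -/
  pl : ℕ → RatPlace
  /-- The Heegner class `y ∈ H¹(ℚ, W[2])` (at instantiation `δ(T·y_K)`, `T = #E(K)_tors` odd). -/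
  y : galH1Torsion W 2
  /-- `y` is a Selmer class. -/
  y_mem : y ∈ selmerGroup W 2
  /-- `y ≠ 0` (`y_K ∉ 2E(K) + E(K)_tors`, i.e. `m = 0`). -/
  y_ne : y ≠ 0
  /-- Kolyvagin's first-layer classes descended to `ℚ` on `W`. -/
  c₁ : ℕ → galH1Torsion W 2
  /-- Kolyvagin's first-layer classes descended to `ℚ` on the twin `Wd`. -/
  c₂ : ℕ → galH1Torsion Wd 2
  /-- **Gross 6.2 (1) / Lemma 4.3 over `ℚ`, E-side**: `c₁ ℓ` satisfies `W`'s Kummer condition at every place `∉ {pl ℓ, q₀}`. -/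
  c₁_loc : ∀ ℓ, Kol ℓ → ∀ v, v ≠ pl ℓ → v ≠ q₀ → c₁ ℓ ∈ locAt W 2 v
  /-- **Gross 6.2 (2) over `ℚ`, E-side**: `c₁ ℓ` is Kummer at `ℓ` iff `y` vanishes at `ℓ`. -/
  c₁_loc_iff : ∀ ℓ, Kol ℓ → (c₁ ℓ ∈ locAt W 2 (pl ℓ) ↔ y ∈ strictAt W 2 (pl ℓ))
  /-- **Gross 6.2 (1) / Lemma 4.3 over `ℚ`, twin side**: `c₂ ℓ` satisfies `Wd`'s Kummer condition at every place `∉ {pl ℓ, q₀}`. -/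
  c₂_loc : ∀ ℓ, Kol ℓ → ∀ v, v ≠ pl ℓ → v ≠ q₀ → c₂ ℓ ∈ locAt Wd 2 v
  /-- **Gross 6.2 (2) ACROSS (McCallum Prop. 4.4 at depth `ℓ`)**: `c₂ ℓ` is Kummer at `ℓ` iff `y` vanishes at `ℓ`. -/
  c₂_loc_iff : ∀ ℓ, Kol ℓ → (c₂ ℓ ∈ locAt Wd 2 (pl ℓ) ↔ y ∈ strictAt W 2 (pl ℓ))
  /-- **Reciprocity, E-side** (Poitou–Tate for `(s, d)` in `H¹(ℚ, W[2])` + perfect pairing of the lines `H¹_ur`, `H¹/H¹_ur` at `ℓ`). -/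
  rec₁ : ∀ ℓ, Kol ℓ → ∀ d : galH1Torsion W 2, (∀ v, v ≠ pl ℓ → v ≠ q₀ → d ∈ locAt W 2 v) → d ∉ locAt W 2 (pl ℓ) →
    ∀ s : galH1Torsion W 2, (∀ v, v ≠ q₀ → s ∈ locAt W 2 v) → s ∉ strictAt W 2 (pl ℓ) → s ∉ strictAt W 2 q₀
  /-- **Reciprocity, twin side** (the same in `H¹(ℚ, Wd[2])`). -/
  rec₂ : ∀ ℓ, Kol ℓ → ∀ d : galH1Torsion Wd 2, (∀ v, v ≠ pl ℓ → v ≠ q₀ → d ∈ locAt Wd 2 v) → d ∉ locAt Wd 2 (pl ℓ) →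
    ∀ s : galH1Torsion Wd 2, (∀ v, v ≠ q₀ → s ∈ locAt Wd 2 v) → s ∉ strictAt Wd 2 (pl ℓ) → s ∉ strictAt Wd 2 q₀
  /-- **Čebotarev at `M = 2` for `y` alone**: a Kolyvagin prime at which `y` does not vanish. -/
  ceb₁ : ∃ ℓ, Kol ℓ ∧ y ∉ strictAt W 2 (pl ℓ)
  /-- **Čebotarev at `M = 2`, E-side pair**: for a relaxed `s ∉ {0, y}` a Kolyvagin prime singular for both `s` and `y`. -/
  ceb₂ : ∀ s : galH1Torsion W 2, s ≠ 0 → s ≠ y → (∀ v, v ≠ q₀ → s ∈ locAt W 2 v) →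
    ∃ ℓ, Kol ℓ ∧ s ∉ strictAt W 2 (pl ℓ) ∧ y ∉ strictAt W 2 (pl ℓ)
  /-- **Čebotarev at `M = 2`, cross pair**: for a relaxed non-zero `s ∈ H¹(ℚ, Wd[2])` a Kolyvagin prime singular for `s` and `y`. -/
  ceb₂' : ∀ s : galH1Torsion Wd 2, s ≠ 0 → (∀ v, v ≠ q₀ → s ∈ locAt Wd 2 v) →
    ∃ ℓ, Kol ℓ ∧ s ∉ strictAt Wd 2 (pl ℓ) ∧ y ∉ strictAt W 2 (pl ℓ)
  /-- **Mazur–Rubin Lemma 2.2 (i) at `q₀`, E-side**: the Kummer image at the error place is ONE line. -/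
  line₁ : ∀ s t : galH1Torsion W 2, s ∈ locAt W 2 q₀ → t ∈ locAt W 2 q₀ → s ∉ strictAt W 2 q₀ → t ∉ strictAt W 2 q₀ →
    s - t ∈ strictAt W 2 q₀
  /-- **Mazur–Rubin Lemma 2.2 (i) at `q₀`, twin side.** -/
  line₂ : ∀ s t : galH1Torsion Wd 2, s ∈ locAt Wd 2 q₀ → t ∈ locAt Wd 2 q₀ → s ∉ strictAt Wd 2 q₀ → t ∉ strictAt Wd 2 q₀ →
    s - t ∈ strictAt Wd 2 q₀

/-! ### The bottom rung as an EXISTENCE statement: the registered stub of skeleton v8.9 -/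

/-- **`FirstDescentLeavesAtTwoBottom` — at every datum of the bottom rung the input of the first `2`-descent EXISTS** (THEOREM-CANDIDATE;
tagged `conjecture` only because it is unproved in the tree).  Binders VERBATIM as in `DoorIndexLawUpperCAtTwoBottom` (U₀, p639188):
`W` globally minimal, non-CM, `ρ_{W,2^n}` onto for all `n`, odd torsion, odd Tamagawa product, analytic rank one; `K` imaginary quadratic
with `d_K` door-admissible and `L(W^{(d_K)},1) ≠ 0`; a parametrisation datum with `P ∈ E(K)` over its complex Heegner point; `Wd` a
globally minimal model of the twist; the door MINIMAL (`t + 2s = [Δ_W < 0]`); `Dt.c` odd; `P ∉ 2E(K) + E(K)_tors`.  THEN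
`Nonempty (FirstDescentInput W Wd)`.  Through the PROVED glue (`doorIndexLawUpperCAtTwoBottom_of_leaves`, `Theorems/…OneDoorBottomFrame.lean`:
the engine + `doorIndexLawUpperCAtTwoBottom_of_selmerTwo` + `twin_selmerTwo_even_at`) this statement, Gross–Zagier, Kolyvagin,
modularity, Hoffstein–Luo and Cassels–Tate give U₀.  Proof ON PAPER (lead reports G10 §3, G11 §2, §7; MEMO-es §18.11): `q₀` = the
transposition prime of the door (`Δ_W < 0`) or `∞` (`Δ_W > 0`); `Kol` = Gross's primes resp. regular primes at `M = 2`;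
`y = δ(T·y_K)`; `c₁ ℓ`, `c₂ ℓ` = Kolyvagin's `d(ℓ)` descended to `ℚ`; the fields are Gross 3.7/§4/5.4/6.1/6.2 at `M = 2` (route
GenusKolyvaginAtTwo item 24880 at `M = 2` for the relation), Kramer's local norm index (trivial off `q₀`), Poitou–Tate
(tree `poitouTate_sum_localTatePairing_eq_zero_holds`) with local Tate duality for `E[2]/ℚ_ℓ`, Čebotarev in `K(E[2])/ℚ`
(tree `equivariantChebotarevAtTwoR_proof` at `Δ < 0`), Mazur–Rubin 2010 Lemma 2.2 (i).  Why it might fail: only through the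
`p = 2`, first-layer face of Gross's Prop. 6.2; every other leaf is a tree theorem or print valid at `2`.  Census: as U₀ (G11 §6:
812/812 direct, 370/370 contrapositive, 0 violations; supply 2180/2180).  [cite: GrossLMS1991, Props. 6.2, 9.1 and §10]
[cite: McCallumLMS1991, Cor. 3.2, Prop. 4.4, Lemma 5.3] [cite: MazurRubin2010, Lemmas 2.2, 2.10] [cite: Kramer1981, Prop. 6] -/
@[conjecture] def FirstDescentLeavesAtTwoBottom : Prop :=
  ∀ (W : WeierstrassCurve ℚ) [W.IsElliptic] [W.IsGloballyMinimal] [NeZero (W.conductorNorm ℤ)],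
    ¬ W.HasCM → (∀ n : ℕ, W.HasSurjectiveModNGaloisRep ((2 ^ n : ℕ) : ℤ)) → Odd W.torsionOrder → Odd W.tamagawaProduct →
    W.analyticRank = 1 →
    ∀ (K : Type) [Field K] [NumberField K], IsImaginaryQuadratic K →
      DoorAdmissible W (NumberField.discr K) →
      (W.quadraticTwist (NumberField.discr K : ℚ)).entireLFunction 1 ≠ 0 →
      ∀ (Dt : ModularParametrizationData W (W.conductorNorm ℤ))
        (H : HeegnerDatum (W.conductorNorm ℤ) (NumberField.discr K)) (ι : K →+* ℂ)
        (P : (W.baseChange K).toAffine.Point),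
        WeierstrassCurve.Affine.Point.map ι.toRatAlgHom P = heegnerPointComplex Dt H →
        ∀ (Wd : WeierstrassCurve ℚ) [Wd.IsElliptic] [Wd.IsGloballyMinimal] (Cd : WeierstrassCurve.VariableChange ℚ),
          Cd • W.quadraticTwist (NumberField.discr K : ℚ) = Wd →
          transpCount W (NumberField.discr K) + 2 * identCount W (NumberField.discr K) = (if W.Δ < 0 then 1 else 0) → Odd Dt.c →
          HasTwoDivisibilityUpToTorsion W K P 0 →
            Nonempty (FirstDescentInput W Wd)

/-! ### APPEND #2 (lead prover seat `bsd-line-fkl-p1` g12, 2026-08-28T16:2xZ) — LINE v8.10: the input SPLIT BY SIGN and the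
FIRST-LAYER CLASSES as a sub-record

State after the width seat fkl-p2 g10's leaves (`…OneDoorBottomLeavesLines`, `…OneDoorBottomLeavesRec`, `…OneDoorBottomNoInflationDefect`,
`…OneDoorBottomCebotarev`) and the lead's `…OneDoorBottomHeegnerClass` (`exists_heegnerClass_at`): at a datum with `Δ_W < 0` every field of
`FirstDescentInput W Wd` is a tree theorem EXCEPT the six first-layer fields `c₁`, `c₂`, `c₁_loc`, `c₂_loc`, `c₁_loc_iff`, `c₂_loc_iff`
(Kolyvagin's class `d(ℓ)` at level `2` descended to `ℚ` on `W` and on `Wd`, Gross 6.1 off `{ℓ, q₀}`, Gross 6.2 (2) — route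
GenusKolyvaginAtTwo's item 24880 `KolyvaginRelationAtTwo` at `(M, m, l) = (1, 1, ℓ)` plus the descent `K → ℚ`).  This append names that
residue as a sub-record `FirstLayerClasses` with the CONCRETE data of the `Δ_W < 0` instantiation (error place = the transposition prime `q₀`
of the minimal door, Kolyvagin primes = Gross's primes at `M = 2` in the currency of the Čebotarev leaves, `pl ℓ = v_ℓ`, `y` characterised by
`res_K y = κ_K(P)`), states the `Δ_W < 0` residue `FirstLayerClassesAtTwoBottomNeg`, and splits `FirstDescentLeavesAtTwoBottom` by the sign
of `Δ_W` (`…Neg` / `…Pos`, lossless: `firstDescentLeavesAtTwoBottom_of_neg_of_pos`), so that the skeleton v8.10 can carry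
`stub_firstLayerClassesNeg` (through the PROVED assembly `Theorems/…OneDoorBottomAssemblyNeg.lean`) and `stub_firstDescentLeavesPos` (U₀⁺:
error place `∞`, regular primes — MEMO-es §18.11; leaves `line_inr_of_Δ_pos`, `rec_inr` by fkl-p2).  Nothing is asserted. -/

/-- The place `v_ℓ` of a rational prime `ℓ` (junk: `v_2` for non-primes) — the `pl` of the `Δ_W < 0` instantiation (same body as
`GenusExact.VisiblePairAtTwo.pl`, restated to keep this statements module free of route GenusKolyvaginAtTwo's LINE-6 imports). [folklore] -/
def plOfNat (ℓ : ℕ) : RatPlace :=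
  if h : ℓ.Prime then Sum.inl (Rat.HeightOneSpectrum.primesEquiv.symm ⟨ℓ, h⟩) else Sum.inl (Rat.HeightOneSpectrum.primesEquiv.symm ⟨2, Nat.prime_two⟩)

/-- `plOfNat ℓ = v_ℓ` for `ℓ` prime. [folklore] -/
theorem plOfNat_of_prime {ℓ : ℕ} (hℓ : ℓ.Prime) :
    plOfNat ℓ = Sum.inl (Rat.HeightOneSpectrum.primesEquiv.symm ⟨ℓ, hℓ⟩ : HeightOneSpectrum (𝓞 ℚ)) :=
  dif_pos hℓ

/-- **The Kolyvagin primes of the `Δ_W < 0` instantiation at `M = 2`** — VERBATIM the output of the width seat's Čebotarev leaves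
(`ceb₁_rat` / `ceb₂_rat` / `ceb₂'_rat`, from route GenusKolyvaginAtTwo's `cebotarev_visible_rat_of_not_isSquare`): `Frob_ℓ = Frob_∞` on
`K(E[2])` (a transposition on `E[2]` at `Δ_W < 0`, `ℓ` inert in `K`), a Zhang–Kolyvagin prime at `2` of level `N_W`, Kolyvagin index `≥ 1`.
[cite: GrossLMS1991, §3 (3.1)–(3.3)] [cite: WZhang2014, Notations (xii)] -/
def KolNeg (W : WeierstrassCurve ℚ) [W.IsGloballyMinimal] (K : Type) [Field K] [NumberField K] (ℓ : ℕ) : Prop :=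
  FrobEqFrobInfty W K 2 ℓ ∧ Zhang2014.IsKolyvaginPrime (W.conductorNorm ℤ) W K 2 ℓ ∧ 1 ≤ Zhang2014.kolyvaginIndex W 2 ℓ

/-- **`FirstLayerClasses W Wd q₀ Kol pl y` — the six FIRST-LAYER fields of `FirstDescentInput W Wd` as a sub-record** with the error place,
the Kolyvagin primes, their places and the Heegner class as PARAMETERS: descended classes `c₁ ℓ ∈ H¹(ℚ, W[2])`, `c₂ ℓ ∈ H¹(ℚ, Wd[2])` of
Kolyvagin's `d(ℓ)` at level `2`, Gross 6.1 / Lemma 4.3 over `ℚ` off `{pl ℓ, q₀}` on each side, Gross 6.2 (2) over `ℚ` direct and across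
(`↔ y` vanishes at `pl ℓ`).  The one residue of the bottom rung at `Δ_W < 0` that is not a tree theorem: route GenusKolyvaginAtTwo's item
24880 at `(M, m, l) = (1, 1, ℓ)` plus the descent `K → ℚ` (τ-invariance at level `2` is free) and the local descent at `v ∉ {ℓ, q₀}`
(Kramer's norm index is `1` there on a minimal door). [cite: GrossLMS1991, Props. 3.7, 5.4, 6.1, 6.2] [cite: McCallumLMS1991, Lemma 4.3, Prop. 4.4]
[cite: Kramer1981, Prop. 3] -/
structure FirstLayerClasses (W Wd : WeierstrassCurve ℚ) (q₀ : RatPlace) (Kol : ℕ → Prop) (pl : ℕ → RatPlace)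
    (y : galH1Torsion W 2) where
  /-- Kolyvagin's first-layer classes descended to `ℚ` on `W`. -/
  c₁ : ℕ → galH1Torsion W 2
  /-- Kolyvagin's first-layer classes descended to `ℚ` on the twin `Wd`. -/
  c₂ : ℕ → galH1Torsion Wd 2
  /-- **Gross 6.2 (1) / Lemma 4.3 over `ℚ`, E-side**, off `{pl ℓ, q₀}`. -/
  c₁_loc : ∀ ℓ, Kol ℓ → ∀ v, v ≠ pl ℓ → v ≠ q₀ → c₁ ℓ ∈ locAt W 2 v
  /-- **Gross 6.2 (2) over `ℚ`, E-side.** -/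
  c₁_loc_iff : ∀ ℓ, Kol ℓ → (c₁ ℓ ∈ locAt W 2 (pl ℓ) ↔ y ∈ strictAt W 2 (pl ℓ))
  /-- **Gross 6.2 (1) / Lemma 4.3 over `ℚ`, twin side**, off `{pl ℓ, q₀}`. -/
  c₂_loc : ∀ ℓ, Kol ℓ → ∀ v, v ≠ pl ℓ → v ≠ q₀ → c₂ ℓ ∈ locAt Wd 2 v
  /-- **Gross 6.2 (2) ACROSS.** -/
  c₂_loc_iff : ∀ ℓ, Kol ℓ → (c₂ ℓ ∈ locAt Wd 2 (pl ℓ) ↔ y ∈ strictAt W 2 (pl ℓ))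

/-- **`FirstLayerClassesAtTwoBottomNeg` — the first-layer classes EXIST at every bottom-rung datum with `Δ_W < 0`** (THEOREM-CANDIDATE; tagged
`conjecture` only because it is unproved in the tree).  Binders VERBATIM as in `DoorIndexLawUpperCAtTwoBottom` (U₀), then `Δ_W < 0`, a
transposition prime `q₀` of the door (`q₀` prime, `q₀ ∣ d_K`, `(Δ_min/q₀) = −1`; unique since `t = 1`), a `2`-divisibility datum for
`E_K(K̄)` and a class `y ∈ Sel₂(W/ℚ)` with `res_K y = κ_K(P)` (supplied by `exists_heegnerClass_at`).  THEN
`Nonempty (FirstLayerClasses W Wd (Sum.inl v_{q₀}) (KolNeg W K) plOfNat y)`.  Proof ON PAPER: `c₁ ℓ = c₂ ℓ =` the descent of Kolyvagin's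
`d(ℓ) ∈ H¹(K, E[2])^τ` (Gross 3.7/§4/5.4 at `M = 2`; `KolyvaginHeegnerData.kolyvaginClass`); 6.1 over `K` + Kramer's norm index `1` at every
`v ∉ {ℓ, q₀}` of a minimal door (split at `2N`, `3`-cycle primes, `∞` at `Δ < 0`); 6.2 (2) = route GenusKolyvaginAtTwo's item 24880 at
`(1, 1, ℓ)` read over `ℚ_ℓ` (`PropFourFourRat`).  Why it might fail: only through the `p = 2` face of Gross's Prop. 6.2 (item 24880).
Census: as U₀ (G11 §6).  [cite: GrossLMS1991, Props. 3.7, 5.4, 6.1, 6.2] [cite: McCallumLMS1991, Prop. 4.4] [cite: Kramer1981, Prop. 3]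
[cite: MazurRubin2010, Lemma 2.10] -/
@[conjecture] def FirstLayerClassesAtTwoBottomNeg : Prop :=
  ∀ (W : WeierstrassCurve ℚ) [W.IsElliptic] [W.IsGloballyMinimal] [NeZero (W.conductorNorm ℤ)],
    ¬ W.HasCM → (∀ n : ℕ, W.HasSurjectiveModNGaloisRep ((2 ^ n : ℕ) : ℤ)) → Odd W.torsionOrder → Odd W.tamagawaProduct →
    W.analyticRank = 1 →
    ∀ (K : Type) [Field K] [NumberField K], IsImaginaryQuadratic K →
      DoorAdmissible W (NumberField.discr K) →
      (W.quadraticTwist (NumberField.discr K : ℚ)).entireLFunction 1 ≠ 0 →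
      ∀ (Dt : ModularParametrizationData W (W.conductorNorm ℤ))
        (H : HeegnerDatum (W.conductorNorm ℤ) (NumberField.discr K)) (ι : K →+* ℂ)
        (P : (W.baseChange K).toAffine.Point),
        WeierstrassCurve.Affine.Point.map ι.toRatAlgHom P = heegnerPointComplex Dt H →
        ∀ (Wd : WeierstrassCurve ℚ) [Wd.IsElliptic] [Wd.IsGloballyMinimal] (Cd : WeierstrassCurve.VariableChange ℚ),
          Cd • W.quadraticTwist (NumberField.discr K : ℚ) = Wd →
          transpCount W (NumberField.discr K) + 2 * identCount W (NumberField.discr K) = (if W.Δ < 0 then 1 else 0) → Odd Dt.c →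
          HasTwoDivisibilityUpToTorsion W K P 0 →
          W.Δ < 0 →
          ∀ (q₀ : ℕ) (hq₀ : q₀.Prime), (q₀ : ℤ) ∣ NumberField.discr K → jacobiSym W.Δ.num q₀ = -1 →
          ∀ (hdivK : ∀ Q : geomPoints (W.baseChange K), ∃ R : geomPoints (W.baseChange K), (2 : ℤ) • R = Q)
            (y : galH1Torsion W 2), y ∈ selmerGroup W 2 →
            resTorsion W K 2 y = kummerMapTorsion (W.baseChange K) 2 hdivK P →
              Nonempty (FirstLayerClasses W Wd (Sum.inl (Rat.HeightOneSpectrum.primesEquiv.symm ⟨q₀, hq₀⟩)) (KolNeg W K) plOfNat y)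

/-- **`FirstDescentLeavesAtTwoBottomNeg`** — `FirstDescentLeavesAtTwoBottom` restricted to `Δ_W < 0` (the corner U₀⁻; PROVED from
`FirstLayerClassesAtTwoBottomNeg` and print in `Theorems/…OneDoorBottomAssemblyNeg.lean`; tagged `conjecture` only because unproved here).
[cite: GrossLMS1991, §10] [cite: Kolyvagin1989Izv, §3] -/
@[conjecture] def FirstDescentLeavesAtTwoBottomNeg : Prop :=
  ∀ (W : WeierstrassCurve ℚ) [W.IsElliptic] [W.IsGloballyMinimal] [NeZero (W.conductorNorm ℤ)],
    ¬ W.HasCM → (∀ n : ℕ, W.HasSurjectiveModNGaloisRep ((2 ^ n : ℕ) : ℤ)) → Odd W.torsionOrder → Odd W.tamagawaProduct →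
    W.analyticRank = 1 →
    ∀ (K : Type) [Field K] [NumberField K], IsImaginaryQuadratic K →
      DoorAdmissible W (NumberField.discr K) →
      (W.quadraticTwist (NumberField.discr K : ℚ)).entireLFunction 1 ≠ 0 →
      ∀ (Dt : ModularParametrizationData W (W.conductorNorm ℤ))
        (H : HeegnerDatum (W.conductorNorm ℤ) (NumberField.discr K)) (ι : K →+* ℂ)
        (P : (W.baseChange K).toAffine.Point),
        WeierstrassCurve.Affine.Point.map ι.toRatAlgHom P = heegnerPointComplex Dt H →
        ∀ (Wd : WeierstrassCurve ℚ) [Wd.IsElliptic] [Wd.IsGloballyMinimal] (Cd : WeierstrassCurve.VariableChange ℚ),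
          Cd • W.quadraticTwist (NumberField.discr K : ℚ) = Wd →
          transpCount W (NumberField.discr K) + 2 * identCount W (NumberField.discr K) = (if W.Δ < 0 then 1 else 0) → Odd Dt.c →
          HasTwoDivisibilityUpToTorsion W K P 0 → W.Δ < 0 →
            Nonempty (FirstDescentInput W Wd)

/-- **`FirstDescentLeavesAtTwoBottomPos`** — `FirstDescentLeavesAtTwoBottom` restricted to `0 < Δ_W` (the corner U₀⁺ of MEMO-es §18.11: error
place `∞`, REGULAR Kolyvagin primes; leaves `line_inr_of_Δ_pos`, `rec_inr` by fkl-p2; supply = -es's `RegularPrimeSupplyAtTwo`).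
[cite: GrossLMS1991, §10] [cite: Kramer1981, Prop. 6] -/
@[conjecture] def FirstDescentLeavesAtTwoBottomPos : Prop :=
  ∀ (W : WeierstrassCurve ℚ) [W.IsElliptic] [W.IsGloballyMinimal] [NeZero (W.conductorNorm ℤ)],
    ¬ W.HasCM → (∀ n : ℕ, W.HasSurjectiveModNGaloisRep ((2 ^ n : ℕ) : ℤ)) → Odd W.torsionOrder → Odd W.tamagawaProduct →
    W.analyticRank = 1 →
    ∀ (K : Type) [Field K] [NumberField K], IsImaginaryQuadratic K →
      DoorAdmissible W (NumberField.discr K) →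
      (W.quadraticTwist (NumberField.discr K : ℚ)).entireLFunction 1 ≠ 0 →
      ∀ (Dt : ModularParametrizationData W (W.conductorNorm ℤ))
        (H : HeegnerDatum (W.conductorNorm ℤ) (NumberField.discr K)) (ι : K →+* ℂ)
        (P : (W.baseChange K).toAffine.Point),
        WeierstrassCurve.Affine.Point.map ι.toRatAlgHom P = heegnerPointComplex Dt H →
        ∀ (Wd : WeierstrassCurve ℚ) [Wd.IsElliptic] [Wd.IsGloballyMinimal] (Cd : WeierstrassCurve.VariableChange ℚ),
          Cd • W.quadraticTwist (NumberField.discr K : ℚ) = Wd →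
          transpCount W (NumberField.discr K) + 2 * identCount W (NumberField.discr K) = (if W.Δ < 0 then 1 else 0) → Odd Dt.c →
          HasTwoDivisibilityUpToTorsion W K P 0 → 0 < W.Δ →
            Nonempty (FirstDescentInput W Wd)

/-- **The sign split is LOSSLESS**: `FirstDescentLeavesAtTwoBottom ⟸ …Neg ∧ …Pos` (`Δ_W ≠ 0` for an elliptic curve). [folklore] -/
theorem firstDescentLeavesAtTwoBottom_of_neg_of_pos (hneg : FirstDescentLeavesAtTwoBottomNeg) (hpos : FirstDescentLeavesAtTwoBottomPos) :
    FirstDescentLeavesAtTwoBottom := by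
  intro W _ _ _ hCM hsurj hT hc hr K _ _ hK hadm hLt Dt H ι P hP Wd _ _ Cd hWd hmin hodd hm
  rcases lt_or_gt_of_ne (W.isUnit_Δ.ne_zero) with hΔ | hΔ
  · exact hneg W hCM hsurj hT hc hr K hK hadm hLt Dt H ι P hP Wd Cd hWd hmin hodd hm hΔ
  · exact hpos W hCM hsurj hT hc hr K hK hadm hLt Dt H ι P hP Wd Cd hWd hmin hodd hm hΔ

/-- The converse bookkeeping: `FirstDescentLeavesAtTwoBottom ⟹ …Neg`. [folklore] -/
theorem firstDescentLeavesAtTwoBottomNeg_of (h : FirstDescentLeavesAtTwoBottom) : FirstDescentLeavesAtTwoBottomNeg := by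
  intro W _ _ _ hCM hsurj hT hc hr K _ _ hK hadm hLt Dt H ι P hP Wd _ _ Cd hWd hmin hodd hm _hΔ
  exact h W hCM hsurj hT hc hr K hK hadm hLt Dt H ι P hP Wd Cd hWd hmin hodd hm

/-- The converse bookkeeping: `FirstDescentLeavesAtTwoBottom ⟹ …Pos`. [folklore] -/
theorem firstDescentLeavesAtTwoBottomPos_of (h : FirstDescentLeavesAtTwoBottom) : FirstDescentLeavesAtTwoBottomPos := by
  intro W _ _ _ hCM hsurj hT hc hr K _ _ hK hadm hLt Dt H ι P hP Wd _ _ Cd hWd hmin hodd hm _hΔ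
  exact h W hCM hsurj hT hc hr K hK hadm hLt Dt H ι P hP Wd Cd hWd hmin hodd hm

end Summit.BirchSwinnertonDyer.BirchSwinnertonDyer.Theorems.RankOneAtTwoOneDoor

end
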